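import Literature.MathematicalPhysics.QuantumFieldTheory.Balaban1983to89.B3Ineq213Vertices

/-!
# B3 (2.13) / (1.33) END TO END for the subgraph `G₁` of p. 425 with its ACTUAL line `G_k(□,0)`: every hypothesis of
# p19's chain inhabited by the kernel for the zero-field box line class (lines, vertices AND the degree positivity)

T. Bałaban, *(Higgs)₂,₃ quantum fields in a finite volume. III. Renormalization*, Commun. Math. Phys. **88** (1983)
411–445 [Balaban1983Higgs3], Sect. 2, pp. 424–427 [PDF 14–17] (journal page = PDF page + 410; held text
`paper:balaban1983-higgs-2-3-quantum-fields-finite-volume`).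

statement-level skeleton of published theorems with citation tags; proofs where landed; nothing here is a claim about
the Yang–Mills mass gap

Cell `lit-balaban` (HOME `run/shared/lean/pub/lit-balaban/`), Phase-2 proof seat `lit-balaban-p03` gen 5, row
**B3.Eq2.13-2.14** (owner r15).  THEOREMS plus one abbreviation (`exCounts`) and one definition with body (`exAmp`); imports
this seat's `B3Ineq213Vertices` (→ `B3Ineq213ZeroBoxLines`).  In the spirit of p19's `B3Ineq213Example` (which inhabits the
chain with a line kernel EQUAL to the bound (2.10)); here the line IS the zero-field box propagator.  No new `def … : Prop`;
no existing declaration is modified.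

## What is here

The subgraph `G₁` of p. 425 (*"G₁ is formed by the line l(1) and two vertices at the endpoints of this line"*): one
undifferentiated scalar line `0 → 1` in `d + 1 = 3`, `L = 2`, as a graph of the zero-field box line class (`twoVertexGraph` of
file 3; counts `exCounts = boxCounts twoVertexGraph 2 1 …` with the window `[1/2, 2] × [0, 1]`).  Its generalized graph has
`D(G₁) = (3 + 0) + (3 + 0) − 3 + (2 − 3) = 2 > 0` (`ex_D_one`, (2.2) evaluated by the kernel), so Proposition 2.2's positivity
hypothesis holds (`ex_pos`); the amplitude `exAmp k □` at scale `k + 1` (`η = 2^{−(k+1)}`, box `□ = [0,1)³`, line = the (2.6) pieces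
of `G_{k+1}(□, 0)` at `a = 1`, `m² = 0`, vertex functions = the concrete `twoVertexFields` of file 6: one bounded external scalar
leg per vertex, `u_v ≡ 1`) is a member of p19's class with NO hypothesis left, and **`ex_bound133`** is (1.33) for it:
`|Σ_{j∈J(l̃)} E(G₁(j), {□(v)})| ≤ C² · const215(G₁) · e^{−(δ₁/2)·d({□(0),□(1)})}` with `C`, `δ₁` the (2.10) constants of the box
line kernels (`const`, `delta1` of file 3) — for every `k` and every placement of the two unit cubes.
-/

namespace Literature.MathematicalPhysics.QuantumFieldTheory.Balaban1983to89.B3Ineq213ZeroBoxExample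

open Finset
open Literature.MathematicalPhysics.QuantumFieldTheory.Balaban1983to89.B3Ineq215
open Literature.MathematicalPhysics.QuantumFieldTheory.Balaban1983to89.B3Ineq213
open Literature.MathematicalPhysics.QuantumFieldTheory.Balaban1983to89.B3Ineq213ZeroBoxLines
open Literature.MathematicalPhysics.QuantumFieldTheory.Balaban1983to89.B3Ineq213Vertices

noncomputable section

/-- positivity of the lower window edge `1/2`. [folklore] -/
private theorem half_pos' : (0 : ℝ) < 1 / 2 := by norm_num

/-- the counts of `G₁` as a graph of the zero-field box line class: `d + 1 = 3`, `L = 2`, window `[1/2, 2] × [0, 1]`.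
[cite: Balaban1983Higgs3, (2.15) p.427] -/
abbrev exCounts : Counts (Fin 2) 1 := boxCounts twoVertexGraph 2 1 le_rfl (1 / 2) 2 1 half_pos'

/-- after shrinking the only line both vertices lie in the block of the first endpoint. [cite: Balaban1983Higgs3, (2.16) p.428] -/
theorem ex_rep_one (v : Fin 2) : exCounts.toModel.rep 1 v = 0 := by
  rw [exCounts.toModel.rep_succ Nat.zero_lt_one v]
  unfold Model.rho Model.bs Model.bt
  simp only [Model.rep_zero]
  fin_cases v <;> simp [Counts.toModel, boxCounts, twoVertexGraph]

/-- the block of `G/G₁`'s single vertex is everything. [cite: Balaban1983Higgs3, (2.16) p.428] -/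
theorem ex_fiber_one : exCounts.toModel.fiber 1 0 = Finset.univ := by
  ext v; simp [Model.mem_fiber, ex_rep_one]

/-- its line set is the single line. [cite: Balaban1983Higgs3, (2.16) p.428] -/
theorem ex_before_one : exCounts.toModel.before 1 0 = Finset.univ := by
  ext l
  simp only [Model.mem_before, ex_rep_one, and_true, Finset.mem_univ, iff_true]
  exact l.isLt

/-- the vertices of `G/G₁`: just `0`. [cite: Balaban1983Higgs3, (2.16) p.428] -/
theorem ex_reps_one : exCounts.toModel.reps 1 = {0} := by
  ext b; simp [Model.mem_reps, ex_rep_one, eq_comm]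

/-- **(2.2)** evaluated by the kernel for `G₁` in the box line class: `D(G₁) = (3+0) + (3+0) − 3 + (2 − 3) = 2`.
[cite: Balaban1983Higgs3, (2.2) p.423] -/
theorem ex_D_one : exCounts.toModel.D 1 0 = 2 := by
  unfold Model.D
  rw [ex_fiber_one, ex_before_one]
  have ha : ∀ l : Fin 1, exCounts.toModel.a l = 2 - ((2 + 1 : ℕ) : ℝ) := fun l => toModel_a twoVertexGraph 2 1 le_rfl _ _ _ _ l
  simp only [Finset.sum_const, Finset.card_univ, Fintype.card_fin, ha]
  simp [Counts.toModel, boxCounts, twoVertexGraph]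
  norm_num

/-- **Proposition 2.2's positivity hypothesis holds for `G₁`**: `D(G₁) = 2 > 0` (and `G₀` has no component).
[cite: Balaban1983Higgs3, (2.15) p.427, Prop. 2.2 p.428] -/
theorem ex_pos : ∀ i, i ≤ 1 → ∀ b ∈ exCounts.toModel.reps i, exCounts.toModel.Nontriv i b → 0 < exCounts.toModel.D i b := by
  intro i hi b hb hn
  interval_cases i
  · exact absurd hn (by simp [Model.Nontriv, Model.before_zero])
  · rw [ex_reps_one, Finset.mem_singleton] at hb
    subst hb
    rw [ex_D_one]; norm_num

/-- **The amplitude of `G₁` with its ACTUAL line**: scale `k + 1` (`η = 2^{−(k+1)}`), box `□ = [0,1)³` (`M ≡ 1`), line kernel = the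
(2.6) pieces of `G_{k+1}(□,0)` at `a = 1`, `m² = 0`, the two unit cubes `□(0), □(1)` placed by `box`, vertices = the concrete vertex
functions `twoVertexFields` (one bounded external scalar leg each). [cite: Balaban1983Higgs3, (2.13) p.426] -/
def exAmp (k : ℕ) (box : Fin 2 → Fin 3 → ℕ) : Amp exCounts.toModel :=
  boxAmp twoVertexGraph 2 1 le_rfl (1 / 2) 2 1 half_pos' (k := k + 1) (Nat.succ_le_succ (Nat.zero_le k)) (a := 1) (m2 := 0)
    (by norm_num) (by norm_num) le_rfl (by norm_num) (fun _ => 1) (fun _ => le_rfl) box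
    ((twoVertexFields 2 1 (k + 1)).toVertexData twoVertexGraph.etaPow)

/-- the line of `exAmp` is the box propagator's piece kernel. [cite: Balaban1983Higgs3, (2.6) p.424] -/
theorem exAmp_K (k : ℕ) (box : Fin 2 → Fin 3 → ℕ) (t : ℕ) (x x' : Fin 3 → ℕ) :
    (exAmp k box).K 0 t x x' = lineK 1 (k + 1) (fun _ => 1) 1 0 t x x' := rfl

/-- **(1.33) END TO END for `G₁` with its actual line `G_{k+1}(□,0)`** — p19's `Amp.bound133` with EVERY hypothesis inhabited
(lines: file 3; vertices: file 6; degree positivity: `ex_pos`): for every `k` and every placement of the two unit cubes,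
`|Σ_{j∈J(l̃)} E(G₁(j), {□(v)})| ≤ C · const215(G₁) · e^{−(δ₁/2)·d({□(v)})}` (`C`, `δ₁` = the (2.10) constants of the box line
kernels). [cite: Balaban1983Higgs3, (1.33) p.420, (2.13) p.426] -/
theorem ex_bound133 (k : ℕ) (box : Fin 2 → Fin 3 → ℕ) :
    |∑ j ∈ Model.Mon 1 (k + 1), (exAmp k box).E j|
      ≤ const 2 1 le_rfl (1 / 2) 2 1 half_pos' * exCounts.toModel.const215
          * Real.exp (-(delta1 2 1 le_rfl (1 / 2) 2 1 half_pos' / 2 * boxTreeLen 2 (k + 1) box)) := by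
  unfold exAmp
  have h := bound133_boxAmp twoVertexGraph 2 1 le_rfl (1 / 2) 2 1 half_pos' (k := k + 1) (Nat.succ_le_succ (Nat.zero_le k))
    (a := 1) (m2 := 0) (by norm_num) (by norm_num) le_rfl (by norm_num) (fun _ => 1) (fun _ => le_rfl) box
    ((twoVertexFields 2 1 (k + 1)).toVertexData twoVertexGraph.etaPow) ex_pos
  have h2 : ((twoVertexFields 2 1 (k + 1)).toVertexData twoVertexGraph.etaPow).eRun
        ^ (∑ v, ((twoVertexFields 2 1 (k + 1)).toVertexData twoVertexGraph.etaPow).dv v)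
      * ((twoVertexFields 2 1 (k + 1)).toVertexData twoVertexGraph.etaPow).lamRun
        ^ (∑ v, ((twoVertexFields 2 1 (k + 1)).toVertexData twoVertexGraph.etaPow).ds v) = 1 := by
    simp [VertexFields.toVertexData, twoVertexFields]
  have h4 : (∏ v, ((twoVertexFields 2 1 (k + 1)).toVertexData twoVertexGraph.etaPow).NPhi v) = 1 := by
    simp [VertexFields.toVertexData, VertexFields.NPhi, twoVertexFields]
  have h5 : (∏ v, ((twoVertexFields 2 1 (k + 1)).toVertexData twoVertexGraph.etaPow).NA v) = 1 := by
    simp [VertexFields.toVertexData, VertexFields.NA, twoVertexFields]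
  rw [h2, h4, h5, show (1 + 1 : ℕ) = 2 from rfl] at h
  simpa only [one_mul, mul_one, Finset.prod_const, Finset.card_univ, Fintype.card_fin, pow_one] using h

end

end Literature.MathematicalPhysics.QuantumFieldTheory.Balaban1983to89.B3Ineq213ZeroBoxExample
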